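import Summits.QuantumFields.YangMills.Theorems.ParabolicTrajectoryContinuumLimitOnTrajectoryStubSync
import Summits.QuantumFields.YangMills.Theorems.ParabolicTrajectoryContinuumLimitOnTrajectoryStubAnatomy
import Summits.QuantumFields.YangMills.Theorems.ParabolicTrajectoryContinuumLimitOnTrajectoryDefsD
import Summits.QuantumFields.YangMills.Theorems.ParabolicTrajectoryContinuumLimitOnTrajectoryStubOSLegsD_Assembly
import Summits.QuantumFields.YangMills.Theorems.ParabolicTrajectoryContinuumLimitOnTrajectoryStubAxisSymmetry
import Summits.QuantumFields.YangMills.Theorems.ParabolicTrajectoryContinuumLimitOnTrajectoryStubTransl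
import Summits.QuantumFields.YangMills.Theorems.ParabolicTrajectoryContinuumLimitOnTrajectoryStubArp
import Summits.QuantumFields.YangMills.Theorems.ParabolicTrajectoryContinuumLimitOnTrajectoryStubUclOfGap
import Summits.QuantumFields.YangMills.Theorems.ParabolicTrajectoryContinuumLimitOnTrajectorySlabRP

/-!
# Route `ParabolicTrajectory`, crux `ContinuumLimitOnTrajectory` (stmt-QuantumFields-10522): the reduction of line `two-orbit-synchronisation` as a TREE THEOREM

Helper file of the line lead (seat c3, `prover-line-stmt-QuantumFields-10522-c3-0`). The composition of the line's
skeleton (`Cruxes/ContinuumLimitOnTrajectory/Lines/two_orbit_synchronisation.lean`, v3.3 by seat c2, v3.4 by this seat)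
has been sorry-free since v1 but lived only in the crux work file. With every lattice-kinematics stub now LANDED
(`stub_sync` p87541, `stub_anatomy` p87547, `stub_osPackaging` p90720, `stub_axisSymmetry` p115410, `stub_arp` p116117,
`stub_transl` p119243, `stub_uclOfGap` p123780) and the slab reflection positivity discharged (`torusSlabRP_of_tendsto`,
p124885), the reduction itself is recorded here as a kernel-checked theorem over the tree:

* `pair_bound` — the deterministic pairwise synchronisation bound of two terminal orbit points (verbatim from the work
  file, seat -0/c2; consumed by the Cauchy argument);
* `reduction` — `TwoOrbitSync → ChartExists → Anatomy → VolumeClause → IRPhysics → UVPhysics → ARPOfRP → TranslOfUUVB →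
  AxisSymmetry → UCLOfGap → OneFieldOSLegs' → ContinuumLimitOnTrajectory` (the v3.3 composition with the v3.4 inputs:
  the volume clause quarantined on its own, `UVB` derived from `UUVB` by `uvb_of_uuvb`, and the approximate-RP stub fed by
  `torusSlabRP_of_tendsto` — odd-torus reflection positivity + `β_k → ∞` — instead of crux (B)\'s `TorusOSGap`, which now
  feeds the clustering input `UCL` alone);
* `continuumLimitOnTrajectory_of_inputs` — **the crux BY NAME from exactly four named statements**: the PROMOTED chart
  `ChartExists` (Bałaban\'s complete step along Wilson orbits with Lipschitz large-field differences, weak-coupling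
  thermodynamic limits, readout pin, exit massiveness), the QUARANTINED volume clause `VolumeClause` (the misstatement of
  (A) as typed: torus-seam report `SEAM-two-orbit-synchronisation.md`; trivial once (A) carries `PolyVolumeGrowth sch`),
  and the two physics inputs `IRPhysics` (rate-free finite size + a torus OS gap in crux (B)\'s currency) and `UVPhysics`
  (uniform-threshold plaquette-string bounds, rotation restoration, non-degenerate two- and three-point limits).

Nothing here is an input or a named fact: the four hypotheses are explicit antecedents of the final implication, whose
consequent is `Summit.QuantumFields.YangMills.Theses.ParabolicTrajectory.ContinuumLimitOnTrajectory` verbatim.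
Refs: line card `Lines/two-orbit-synchronisation.md`; `…Defs`/`…DefsB`/`…DefsC`/`…DefsD`.
-/

set_option autoImplicit false

open scoped SchwartzMap
open MeasureTheory Filter Topology
open Literature.MathematicalPhysics.QuantumFieldTheory Literature.MathematicalPhysics.QuantumLattice
open Literature.MathematicalPhysics.AQFT Literature.Probability.LatticeModels
open Summit.QuantumFields.YangMills.Theses.ParabolicTrajectory

noncomputable section

namespace Summit.QuantumFields.YangMills.Cruxes.ContinuumLimitOnTrajectory.TwoOrbitSynchronisation

namespace Reduction

/-! ## §1 The pairwise synchronisation bound (deterministic core of the Cauchy argument; verbatim from the work file) -/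

section Pair

variable {G : Type} [Group G] [TopologicalSpace G] [IsTopologicalGroup G] [CompactSpace G]
  [MeasurableSpace G] [BorelSpace G] {r : LatticeRep G} {M : ℕ} (𝒞 : TwoOrbitChart G r M)

/-- **Pair bound.** Two terminal orbit points (depths `J, J' ≥ j₀`, `γ'`-histories, small fibres from `j₀` on,
terminal couplings `≥ g_low`) are close in `ℝ × E` in terms of (i) the difference of their readouts, (ii) the
depth slack `η (min J J')` and (iii) `θ₁ ^ (min J J' − j₀)`: the synchronisation lemma (hypothesis `hS`, the
conclusion shape of `TwoOrbitSync`) applied to the REVERSED difference sequences built from `marg_diff` /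
`fibre_diff`, closed by the pin (hypothesis `hpin`, the conclusion shape of `TwoOrbitChart.pin`) and the
smallness `K C₁ ℓ₀ γ' ≤ 1/2`. -/
theorem pair_bound {γ' K θ₁ c_r g_low : ℝ} {m t : ℕ} {η : ℕ → ℝ}
    (hγ'pos : 0 < γ') (hγ'le : γ' ≤ 𝒞.γ) (hK : 0 ≤ K) (hθ₁ : 0 ≤ θ₁) (hc_r : 0 < c_r)
    (hsmall : K * 𝒞.C₁ * (𝒞.ℓ₀ * γ') ≤ 1 / 2)
    (hS : ∀ (Jc : ℕ) (a b : ℕ → ℝ), (∀ i, 0 ≤ a i) → (∀ i, 0 ≤ b i) →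
      (∀ i, i < Jc → a (i + 1) ≤ (1 + 𝒞.Cκ * γ' ^ 2) * a i + 𝒞.C₃ * γ' ^ 3 * b (i + 1)) →
      (∀ i, i < Jc → b i ≤ 𝒞.θ' * b (i + 1) + 𝒞.C₁ * a (i + 1)) →
        b 0 ≤ K * θ₁ ^ Jc * b Jc + K * 𝒞.C₁ * a 0)
    (hpin : ∀ g g' : ℝ, g ∈ Set.Ioc (0 : ℝ) 𝒞.g₀ → g' ∈ Set.Ioc (0 : ℝ) 𝒞.g₀ → ∀ J J' : ℕ,
      𝒞.j₀ ≤ J → 𝒞.j₀ ≤ J' → (∀ i ≤ J, (𝒞.orb g i).1 ≤ γ') → (∀ i ≤ J', (𝒞.orb g' i).1 ≤ γ') →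
      g_low ≤ (𝒞.orb g J).1 → g_low ≤ (𝒞.orb g' J').1 → ‖(𝒞.orb g J).2‖ ≤ 𝒞.ρ → ‖(𝒞.orb g' J').2‖ ≤ 𝒞.ρ →
        c_r * |(𝒞.orb g J).1 - (𝒞.orb g' J').1| ≤
          |𝒞.Rd m t g J - 𝒞.Rd m t g' J'| + c_r * (𝒞.ℓ₀ * γ') * ‖(𝒞.orb g J).2 - (𝒞.orb g' J').2‖ +
            η (min J J'))
    {g g' : ℝ} {J J' : ℕ} (hg : g ∈ Set.Ioc (0 : ℝ) 𝒞.g₀) (hg' : g' ∈ Set.Ioc (0 : ℝ) 𝒞.g₀)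
    (hJ : 𝒞.j₀ ≤ J) (hJ' : 𝒞.j₀ ≤ J')
    (hw : ∀ i ≤ J, (𝒞.orb g i).1 ∈ Set.Icc 0 γ') (hw' : ∀ i ≤ J', (𝒞.orb g' i).1 ∈ Set.Icc 0 γ')
    (hf : ∀ i, 𝒞.j₀ ≤ i → i ≤ J → ‖(𝒞.orb g i).2‖ ≤ 𝒞.ρ)
    (hf' : ∀ i, 𝒞.j₀ ≤ i → i ≤ J' → ‖(𝒞.orb g' i).2‖ ≤ 𝒞.ρ)
    (hlow : g_low ≤ (𝒞.orb g J).1) (hlow' : g_low ≤ (𝒞.orb g' J').1) :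
    dist (𝒞.orb g J) (𝒞.orb g' J') ≤
      (1 + K * 𝒞.C₁) * ((2 / c_r) * (|𝒞.Rd m t g J - 𝒞.Rd m t g' J'| + |η (min J J')|) +
          4 * 𝒞.ℓ₀ * γ' * K * 𝒞.ρ * θ₁ ^ (min J J' - 𝒞.j₀)) +
        2 * K * 𝒞.ρ * θ₁ ^ (min J J' - 𝒞.j₀) := by
  -- comparison length and index bookkeeping
  set Jc : ℕ := min J J' - 𝒞.j₀ with hJc_def
  have hJcJ : Jc + 𝒞.j₀ ≤ J := by
    have : min J J' - 𝒞.j₀ + 𝒞.j₀ = min J J' := Nat.sub_add_cancel (le_min hJ hJ')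
    have h2 : min J J' ≤ J := min_le_left _ _
    omega
  have hJcJ' : Jc + 𝒞.j₀ ≤ J' := by
    have : min J J' - 𝒞.j₀ + 𝒞.j₀ = min J J' := Nat.sub_add_cancel (le_min hJ hJ')
    have h2 : min J J' ≤ J' := min_le_right _ _
    omega
  -- the reversed difference sequences
  set a : ℕ → ℝ := fun i => |(𝒞.orb g (J - i)).1 - (𝒞.orb g' (J' - i)).1| with ha_def
  set b : ℕ → ℝ := fun i => ‖(𝒞.orb g (J - i)).2 - (𝒞.orb g' (J' - i)).2‖ with hb_def
  have ha0 : ∀ i, 0 ≤ a i := fun i => abs_nonneg _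
  have hb0 : ∀ i, 0 ≤ b i := fun i => norm_nonneg _
  -- the two difference inequalities along the comparison window
  have hM : ∀ i, i < Jc → a (i + 1) ≤ (1 + 𝒞.Cκ * γ' ^ 2) * a i + 𝒞.C₃ * γ' ^ 3 * b (i + 1) := by
    intro i hi
    have e1 : J - (i + 1) + 1 = J - i := by omega
    have e2 : J' - (i + 1) + 1 = J' - i := by omega
    have h := 𝒞.marg_diff γ' hγ'pos hγ'le g g' hg hg' (J - (i + 1)) (J' - (i + 1))
      (hw _ (by omega)) (hw' _ (by omega)) (hf _ (by omega) (by omega)) (hf' _ (by omega) (by omega))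
    rw [e1, e2] at h
    simpa only [ha_def, hb_def] using h
  have hF : ∀ i, i < Jc → b i ≤ 𝒞.θ' * b (i + 1) + 𝒞.C₁ * a (i + 1) := by
    intro i hi
    have e1 : J - (i + 1) + 1 = J - i := by omega
    have e2 : J' - (i + 1) + 1 = J' - i := by omega
    have h := 𝒞.fibre_diff γ' hγ'pos hγ'le g g' hg hg' (J - (i + 1)) (J' - (i + 1))
      (hw _ (by omega)) (hw' _ (by omega)) (hf _ (by omega) (by omega)) (hf' _ (by omega) (by omega))
    rw [e1, e2] at h
    simpa only [ha_def, hb_def] using h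
  -- synchronisation
  have hsync := hS Jc a b ha0 hb0 hM hF
  -- the initial fibre difference is at most `2ρ`
  have hbJc : b Jc ≤ 2 * 𝒞.ρ := by
    have h1 := hf (J - Jc) (by omega) (by omega)
    have h2 := hf' (J' - Jc) (by omega) (by omega)
    calc b Jc = ‖(𝒞.orb g (J - Jc)).2 - (𝒞.orb g' (J' - Jc)).2‖ := rfl
      _ ≤ ‖(𝒞.orb g (J - Jc)).2‖ + ‖(𝒞.orb g' (J' - Jc)).2‖ := norm_sub_le _ _
      _ ≤ 2 * 𝒞.ρ := by linarith
  -- the pin at the terminal step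
  have hp := hpin g g' hg hg' J J' hJ hJ' (fun i hi => (hw i hi).2) (fun i hi => (hw' i hi).2) hlow hlow'
    (hf J hJ le_rfl) (hf' J' hJ' le_rfl)
  -- abbreviations
  set A : ℝ := |(𝒞.orb g J).1 - (𝒞.orb g' J').1| with hA_def
  set B : ℝ := ‖(𝒞.orb g J).2 - (𝒞.orb g' J').2‖ with hB_def
  set P : ℝ := θ₁ ^ Jc with hP_def
  set D : ℝ := |𝒞.Rd m t g J - 𝒞.Rd m t g' J'| with hD_def
  have hA0 : 0 ≤ A := abs_nonneg _
  have hB0 : 0 ≤ B := norm_nonneg _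
  have hP0 : 0 ≤ P := pow_nonneg hθ₁ _
  have hD0 : 0 ≤ D := abs_nonneg _
  have ha0' : a 0 = A := by simp [ha_def, hA_def]
  have hb0' : b 0 = B := by simp [hb_def, hB_def]
  have hρ := 𝒞.ρ_pos.le
  have hℓ := 𝒞.ℓ₀_nonneg
  have hC₁ := 𝒞.C₁_nonneg
  -- (S): B ≤ 2KρP + K C₁ A
  have hSB : B ≤ K * P * (2 * 𝒞.ρ) + K * 𝒞.C₁ * A := by
    have h1 : K * θ₁ ^ Jc * b Jc ≤ K * P * (2 * 𝒞.ρ) :=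
      mul_le_mul_of_nonneg_left hbJc (mul_nonneg hK hP0)
    have h2 : b 0 ≤ K * θ₁ ^ Jc * b Jc + K * 𝒞.C₁ * a 0 := hsync
    rw [hb0', ha0'] at h2
    linarith
  -- (P): c_r A ≤ D + c_r ℓ₀ γ' B + |η|
  have hPA : c_r * A ≤ D + c_r * (𝒞.ℓ₀ * γ') * B + |η (min J J')| := by
    have := le_abs_self (η (min J J'))
    linarith [hp]
  -- solve for A
  have hAbd : A ≤ (2 / c_r) * (D + |η (min J J')|) + 4 * 𝒞.ℓ₀ * γ' * K * 𝒞.ρ * P := by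
    have hcoef : 0 ≤ c_r * (𝒞.ℓ₀ * γ') := by positivity
    have h1 : c_r * A ≤ D + |η (min J J')| + c_r * (𝒞.ℓ₀ * γ') * (K * P * (2 * 𝒞.ρ)) +
        (K * 𝒞.C₁ * (𝒞.ℓ₀ * γ')) * (c_r * A) := by
      have := mul_le_mul_of_nonneg_left hSB hcoef
      nlinarith [hPA, this]
    have h2 : (K * 𝒞.C₁ * (𝒞.ℓ₀ * γ')) * (c_r * A) ≤ (1 / 2) * (c_r * A) :=
      mul_le_mul_of_nonneg_right hsmall (by positivity)
    have h3 : (1 / 2) * (c_r * A) ≤ D + |η (min J J')| + c_r * (𝒞.ℓ₀ * γ') * (K * P * (2 * 𝒞.ρ)) := by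
      linarith
    have h4 : A = (2 / c_r) * ((1 / 2) * (c_r * A)) := by field_simp
    calc A = (2 / c_r) * ((1 / 2) * (c_r * A)) := h4
      _ ≤ (2 / c_r) * (D + |η (min J J')| + c_r * (𝒞.ℓ₀ * γ') * (K * P * (2 * 𝒞.ρ))) := by
          gcongr
      _ = (2 / c_r) * (D + |η (min J J')|) + 4 * 𝒞.ℓ₀ * γ' * K * 𝒞.ρ * P := by
          field_simp
          ring
  -- conclude
  have hBbd : B ≤ 2 * K * 𝒞.ρ * P + K * 𝒞.C₁ * A := by linarith [hSB]
  have hdist : dist (𝒞.orb g J) (𝒞.orb g' J') ≤ A + B := by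
    rw [Prod.dist_eq, Real.dist_eq, dist_eq_norm]
    exact max_le (le_add_of_nonneg_right hB0) (le_add_of_nonneg_left hA0)
  have hKC : 0 ≤ K * 𝒞.C₁ := mul_nonneg hK hC₁
  calc dist (𝒞.orb g J) (𝒞.orb g' J') ≤ A + B := hdist
    _ ≤ A + (2 * K * 𝒞.ρ * P + K * 𝒞.C₁ * A) := by linarith
    _ = (1 + K * 𝒞.C₁) * A + 2 * K * 𝒞.ρ * P := by ring
    _ ≤ (1 + K * 𝒞.C₁) * ((2 / c_r) * (D + |η (min J J')|) + 4 * 𝒞.ℓ₀ * γ' * K * 𝒞.ρ * P) +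
          2 * K * 𝒞.ρ * P := by
        gcongr

end Pair

/-! ## §2 The reduction (v3.4 inputs) -/

/-- **The reduction.** The eleven statements imply the crux BY NAME (kernel-checked; v3.4 wiring: `VolumeClause`
supplies volume growth, `IRPhysics` the qualitative finite-size clause and a torus OS gap `Δ'`, `UVPhysics` supplies
`UUVB`/`AsympRot`/`ND2`/`ND3` and `UVB` follows by `uvb_of_uuvb`; `ARPOfRP` is fed by `torusSlabRP_of_tendsto` (odd-torus
reflection positivity, `β_k → ∞`), `TranslOfUUVB` (+ `asympEuclid_iff`), `AxisSymmetry` + `UCLOfGap` produce `AsympEuclid`,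
`UCL`; `OneFieldOSLegs'` consumes them). Route through the proof: constants (`κ₀`, then `ε₀, K, θ₁` from `TwoOrbitSync`,
then the sub-window `γ'`); Wilson couplings `g k` from `betaOf_surj` (uses `β_k → ∞`); infinite-volume towers from
`QualFiniteSize` (b) + `corr_tendsto`; `Anatomy` gives the uniform offset `m`, floor `g_low`, terminal steps `J k`; `pin` +
`pair_bound` + the three null sequences give a CAUCHY sequence of terminal chart points, hence a limit `q⋆ ∈ W`;
continuity of `expectInf` at `q⋆`, iterated covariance and the thermodynamic identification + `QualFiniteSize` (a) give
`ConvProducts`; the inputs and the landed lattice-kinematics stubs feed `OneFieldOSLegs'` on the canonical witness. -/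
theorem reduction :
    TwoOrbitSync → ChartExists → Anatomy → VolumeClause → IRPhysics → UVPhysics → ARPOfRP → TranslOfUUVB →
      AxisSymmetry → UCLOfGap → OneFieldOSLegs' → ContinuumLimitOnTrajectory := by
  intro hsync hchart hanat hvol hir huv harp htransl haxis hucl hlegs G _ _ _ _ hG
  letI : MeasurableSpace G := borel G
  haveI : BorelSpace G := ⟨rfl⟩
  intro r
  obtain ⟨M₀, hM₀⟩ := hchart G hG r
  refine ⟨M₀, fun M hM h2M => ?_⟩
  obtain ⟨𝒞⟩ := hM₀ M hM h2M
  /- constants, independent of the tuning -/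
  set κ₀ : ℝ := (1 - 𝒞.θ') / 2 with hκ₀_def
  have h1θ : 0 < 1 - 𝒞.θ' := by linarith [𝒞.θ'_lt_one]
  have hκ₀pos : 0 < κ₀ := by rw [hκ₀_def]; positivity
  have hdom : 𝒞.θ' * (1 + κ₀) < 1 := by
    rw [hκ₀_def]; nlinarith [𝒞.θ'_nonneg, 𝒞.θ'_lt_one, h1θ]
  obtain ⟨ε₀, K, θ₁, hε₀, hK, hθ₁0, hθ₁1, hS⟩ := hsync 𝒞.θ' κ₀ 𝒞.θ'_nonneg hκ₀pos.le hdom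
  -- the sub-window γ'
  have hev : ∀ᶠ x in 𝓝[>] (0 : ℝ), (0 < x ∧ x ≤ 𝒞.γ) ∧ 𝒞.Cκ * x ^ 2 ≤ κ₀ ∧
      𝒞.C₁ * (𝒞.C₃ * x ^ 3) ≤ ε₀ ∧ 8 * 𝒞.b * x ^ 2 ≤ 1 ∧ K * 𝒞.C₁ * (𝒞.ℓ₀ * x) ≤ 1 / 2 := by
    have hIoc : ∀ᶠ x in 𝓝[>] (0 : ℝ), 0 < x ∧ x ≤ 𝒞.γ := by
      filter_upwards [Ioo_mem_nhdsGT 𝒞.γ_pos] with x hx using ⟨hx.1, hx.2.le⟩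
    have hcts : ∀ (c : ℝ) {p : ℕ}, 0 < p → Tendsto (fun x : ℝ => c * x ^ p) (𝓝[>] 0) (𝓝 0) := by
      intro c p hp
      have hc : Continuous (fun x : ℝ => c * x ^ p) := by fun_prop
      have h := (hc.tendsto (0 : ℝ)).mono_left (nhdsWithin_le_nhds (s := Set.Ioi (0 : ℝ)))
      simpa [zero_pow hp.ne'] using h
    have h1 : ∀ᶠ x in 𝓝[>] (0 : ℝ), 𝒞.Cκ * x ^ 2 ≤ κ₀ := (hcts 𝒞.Cκ two_pos).eventually_le_const hκ₀pos
    have h2 : ∀ᶠ x in 𝓝[>] (0 : ℝ), 𝒞.C₁ * (𝒞.C₃ * x ^ 3) ≤ ε₀ :=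
      ((hcts (𝒞.C₁ * 𝒞.C₃) three_pos).eventually_le_const hε₀).mono fun x hx => by
        simpa only [mul_assoc] using hx
    have h3 : ∀ᶠ x in 𝓝[>] (0 : ℝ), 8 * 𝒞.b * x ^ 2 ≤ 1 :=
      (hcts (8 * 𝒞.b) two_pos).eventually_le_const one_pos
    have h4 : ∀ᶠ x in 𝓝[>] (0 : ℝ), K * 𝒞.C₁ * (𝒞.ℓ₀ * x) ≤ 1 / 2 :=
      ((hcts (K * 𝒞.C₁ * 𝒞.ℓ₀) one_pos).eventually_le_const (u := 1 / 2) (by norm_num)).mono fun x hx => by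
        simpa only [mul_assoc, pow_one] using hx
    exact hIoc.and (h1.and (h2.and (h3.and h4)))
  obtain ⟨γ', ⟨hγ'pos, hγ'le⟩, hκle, hprod, h8b, hsmall⟩ := hev.exists
  -- the synchronisation constants at (κ, c₁, c₃) = (Cκ γ'², C₁, C₃ γ'³)
  have hSk := hS (𝒞.Cκ * γ' ^ 2) 𝒞.C₁ (𝒞.C₃ * γ' ^ 3) (by have := 𝒞.Cκ_nonneg; positivity) hκle
    𝒞.C₁_nonneg (by have := 𝒞.C₃_nonneg; positivity) hprod
  /- the tuning data -/
  refine ⟨1, one_pos, fun θ Δ sch n hθ _ hΔ hshape hβ htower htune hgap => ?_⟩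
  have hgrowth : PolyVolumeGrowth sch := hvol G hG r M θ Δ sch n hθ hΔ hshape hβ htower htune hgap
  obtain ⟨hvol', Δ', hΔ', hgap'⟩ := hir G hG r M θ Δ sch n hθ hΔ hshape hβ htower htune hgap hgrowth
  -- Wilson couplings (uses β_k → ∞)
  classical
  let g : ℕ → ℝ := fun k => if h : 𝒞.B₀ ≤ sch.β k then (𝒞.betaOf_surj (sch.β k) h).choose else 𝒞.g₀
  have hgk : ∀ᶠ k in atTop, g k ∈ Set.Ioc (0 : ℝ) 𝒞.g₀ ∧ 𝒞.betaOf (g k) = sch.β k := by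
    filter_upwards [hβ.eventually_ge_atTop 𝒞.B₀] with k hk
    simp only [g, dif_pos hk]
    exact (𝒞.betaOf_surj (sch.β k) hk).choose_spec
  have hgβ : Tendsto (fun k => 𝒞.betaOf (g k)) atTop atTop :=
    hβ.congr' (hgk.mono fun k hk => hk.2.symm)
  have hn : Tendsto n atTop atTop :=
    Summit.QuantumFields.YangMills.Theorems.LatticeGapOnTrajectory.Negative.tendsto_n_of_shape sch hshape
  -- infinite-volume towers (VolumeIndependence (b) + corr_tendsto)
  have hclose : ∀ t : ℕ, 0 < t → ∀ ε : ℝ, 0 < ε → ∀ᶠ k in atTop,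
      |((M : ℝ) ^ n k) ^ 8 *
          latticeConnectedCorr r.ρ (sch.β k) (sch.side k) r.curvature.F r.curvature.F (t * M ^ n k) -
        ((M : ℝ) ^ n k) ^ 8 * 𝒞.corrInf (g k) (t * M ^ n k)| ≤ ε := by
    intro t ht ε hε
    filter_upwards [hvol'.2 t ht ε hε, hgk] with k hk hg'
    have hT := 𝒞.corr_tendsto (g k) hg'.1 (t * M ^ n k)
    rw [hg'.2] at hT
    rw [← mul_sub, abs_mul, abs_of_nonneg (by positivity)]
    refine le_of_tendsto ((tendsto_const_nhds.sub hT).abs.const_mul _) (eventually_atTop.2 ⟨sch.L k, ?_⟩)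
    intro S hS'
    exact hk S hS'
  have htowerInf : ∀ t : ℕ, 0 < t → ∃ c : ℝ,
      Tendsto (fun k => ((M : ℝ) ^ n k) ^ 8 * 𝒞.corrInf (g k) (t * M ^ n k)) atTop (𝓝 c) := by
    intro t ht
    obtain ⟨c, hc⟩ := htower t ht
    exact ⟨c, tendsto_of_forall_eventually_abs_sub_le hc fun ε hε =>
      (hclose t ht ε hε).mono fun k hk => by rwa [abs_sub_comm] at hk⟩
  have htune1 : Tendsto (fun k => ((M : ℝ) ^ n k) ^ 8 * 𝒞.corrInf (g k) (M ^ n k)) atTop (𝓝 θ) := by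
    have h := hclose 1 one_pos
    simp only [one_mul] at h
    exact tendsto_of_forall_eventually_abs_sub_le htune fun ε hε =>
      (h ε hε).mono fun k hk => by rwa [abs_sub_comm] at hk
  /- anatomy (uses θ > 0) -/
  obtain ⟨m, g_low, J, hglow, hJ, hA⟩ :=
    hanat G r M 𝒞 γ' hγ'pos hγ'le h8b θ g n hθ (hgk.mono fun k hk => hk.1) hgβ hn htune1
  /- the pin and its readout sequence -/
  obtain ⟨t, ht, c_r, hc_r, η, hη, hpin⟩ := 𝒞.pin m g_low γ' hglow hγ'pos hγ'le
  obtain ⟨ct, hct⟩ := htowerInf t ht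
  have hRd : Tendsto (fun k => 𝒞.Rd m t (g k) (J k)) atTop (𝓝 ct) := by
    refine hct.congr' ?_
    filter_upwards [hA] with k hk
    rw [TwoOrbitChart.Rd, hk.1]
  /- the terminal chart points form a Cauchy sequence -/
  set q : ℕ → ℝ × 𝒞.E := fun k => 𝒞.orb (g k) (J k) with hq_def
  have hcauchy : CauchySeq q := by
    rw [cauchySeq_iff_tendsto_dist_atTop_0, ← prod_atTop_atTop_eq]
    have hmin : Tendsto (fun p : ℕ × ℕ => min (J p.1) (J p.2)) (atTop ×ˢ atTop) atTop :=
      tendsto_atTop.2 fun b => ((tendsto_atTop.1 (hJ.comp tendsto_fst) b).and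
        (tendsto_atTop.1 (hJ.comp tendsto_snd) b)).mono fun p hp => le_min hp.1 hp.2
    have hD : Tendsto (fun p : ℕ × ℕ => |𝒞.Rd m t (g p.1) (J p.1) - 𝒞.Rd m t (g p.2) (J p.2)|)
        (atTop ×ˢ atTop) (𝓝 0) := by
      have := ((hRd.comp tendsto_fst).sub (hRd.comp tendsto_snd)).abs
      simpa using this
    have hηp : Tendsto (fun p : ℕ × ℕ => |η (min (J p.1) (J p.2))|) (atTop ×ˢ atTop) (𝓝 0) := by
      simpa using (hη.comp hmin).abs
    have hP : Tendsto (fun p : ℕ × ℕ => θ₁ ^ (min (J p.1) (J p.2) - 𝒞.j₀)) (atTop ×ˢ atTop) (𝓝 0) :=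
      (tendsto_pow_atTop_nhds_zero_of_lt_one hθ₁0 hθ₁1).comp ((tendsto_sub_atTop_nat 𝒞.j₀).comp hmin)
    have hbound : Tendsto (fun p : ℕ × ℕ =>
        (1 + K * 𝒞.C₁) * ((2 / c_r) * (|𝒞.Rd m t (g p.1) (J p.1) - 𝒞.Rd m t (g p.2) (J p.2)| +
            |η (min (J p.1) (J p.2))|) + 4 * 𝒞.ℓ₀ * γ' * K * 𝒞.ρ * θ₁ ^ (min (J p.1) (J p.2) - 𝒞.j₀)) +
          2 * K * 𝒞.ρ * θ₁ ^ (min (J p.1) (J p.2) - 𝒞.j₀)) (atTop ×ˢ atTop) (𝓝 0) := by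
      have := ((((hD.add hηp).const_mul (2 / c_r)).add
        (hP.const_mul (4 * 𝒞.ℓ₀ * γ' * K * 𝒞.ρ))).const_mul (1 + K * 𝒞.C₁)).add
        (hP.const_mul (2 * K * 𝒞.ρ))
      simpa using this
    refine squeeze_zero' (Eventually.of_forall fun p => dist_nonneg) ?_ hbound
    filter_upwards [(hA.and hgk).prod_mk (hA.and hgk)] with p hp
    obtain ⟨⟨hA1, hg1⟩, ⟨hA2, hg2⟩⟩ := hp
    exact pair_bound 𝒞 hγ'pos hγ'le hK hθ₁0 hc_r hsmall hSk hpin hg1.1 hg2.1 hA1.2.1 hA2.2.1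
      hA1.2.2.1 hA2.2.2.1 hA1.2.2.2.1 hA2.2.2.2.1 hA1.2.2.2.2 hA2.2.2.2.2
  /- the limit point, inside the closed window region -/
  obtain ⟨qs, hqs⟩ := cauchySeq_tendsto_of_complete hcauchy
  have hqW : ∀ᶠ k in atTop, q k ∈ 𝒞.W := by
    filter_upwards [hA] with k hk
    refine Set.mem_prod.2 ⟨⟨(hk.2.2.1 (J k) le_rfl).1, (hk.2.2.1 (J k) le_rfl).2.trans hγ'le⟩, ?_⟩
    rw [Metric.mem_closedBall, dist_zero_right]
    exact hk.2.2.2.1 (J k) hk.2.1 le_rfl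
  have hqsW : qs ∈ 𝒞.W := 𝒞.isClosed_W.mem_of_tendsto hqs hqW
  /- full-sequence convergence on products -/
  have hconv : ConvProducts r sch := by
    intro p hp f hf
    refine ⟨𝒞.expectInf qs p fun i => (blockDilate M)^[m] (f i), ?_⟩
    have hcont := (𝒞.continuousOn_expect p m f hf).continuousWithinAt hqsW
    have hv : Tendsto (fun k => 𝒞.expectInf (q k) p fun i => (blockDilate M)^[m] (f i)) atTop
        (𝓝 (𝒞.expectInf qs p fun i => (blockDilate M)^[m] (f i))) :=
      hcont.tendsto.comp (tendsto_nhdsWithin_iff.2 ⟨hqs, hqW⟩)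
    refine tendsto_of_forall_eventually_abs_sub_le hv fun ε hε => ?_
    filter_upwards [hvol'.1 p f hf ε hε, hA, hgk] with k hk hAk hg'
    have e1 : (𝒞.expectInf (q k) p fun i => (blockDilate M)^[m] (f i)) =
        𝒞.expectInf (𝒞.orb (g k) 0) p fun i => (blockDilate M)^[n k] (f i) := by
      show 𝒞.expectInf (𝒞.orb (g k) (J k)) p _ = _
      rw [𝒞.expect_iterate hg'.1 (J k) p]
      congr 1
      funext i
      rw [← Function.iterate_add_apply, hAk.1]
    have hlim := 𝒞.expect_wilson (g k) hg'.1 p fun i => (blockDilate M)^[n k] (f i)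
    rw [hg'.2] at hlim
    rw [e1]
    exact abs_sub_le_of_uniform hlim hk
  /- UV inputs, the three lattice-kinematics stubs, and the OS legs -/
  obtain ⟨hUUVB, hRot, hND2, hND3⟩ :=
    huv G hG r M θ Δ sch n hθ hΔ hshape hβ htower htune hgap hgrowth hconv
  have hUVB : UVB r sch := uvb_of_uuvb r sch hUUVB
  have hARP : ARP r sch := harp G r sch (torusSlabRP_of_tendsto r sch hβ) hUUVB hUVB
  have hE1 : AsympEuclid r sch := (asympEuclid_iff r sch).2 ⟨htransl G r sch hgrowth hUUVB, hRot⟩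
  have hUCL : UCL r sch := hucl G r sch (haxis G r sch) hgrowth hUUVB Δ' hΔ' hgap'
  obtain ⟨T, hYM, hNT, hNG⟩ := hlegs G r sch hconv hUVB hE1 hARP hUCL hND2 hND3
  exact ⟨canon r sch, rfl, rfl, rfl, T, hYM, hNT, hNG⟩

end Reduction

/-- **The crux BY NAME from four named statements** (the line's reduction applied to the landed stubs `stub_sync`,
`stub_anatomy`, `stub_arp`, `stub_transl`, `stub_axisSymmetry`, `stub_uclOfGap`, `stub_osPackaging`): the promoted chart,
the quarantined volume clause, the IR physics input and the UV physics input imply `ContinuumLimitOnTrajectory`. -/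
theorem continuumLimitOnTrajectory_of_inputs :
    ChartExists → VolumeClause → IRPhysics → UVPhysics → ContinuumLimitOnTrajectory :=
  fun hchart hvol hir huv =>
    Reduction.reduction stub_sync hchart stub_anatomy hvol hir huv stub_arp stub_transl stub_axisSymmetry stub_uclOfGap
      stub_osPackaging

end Summit.QuantumFields.YangMills.Cruxes.ContinuumLimitOnTrajectory.TwoOrbitSynchronisation

end
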